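import Summits.BirchSwinnertonDyer.BirchSwinnertonDyer.Theorems.PrintCf2DisegniPairTwoQuotientLawOdd
import Literature.NumberTheory.EllipticCurves.PAdicLFunctionNeZeroProofs
import HarnessLib

/-!
# Road (C) `disegni-pair-two` on crux stmt-BirchSwinnertonDyer-20368 — the COMPANION CANCELS on the `χ₋₄∘N`-line
# (`d* = −1`): minus-branch constant term `α⁻²([1/4]⁻ − [3/4]⁻)` vs Birch's odd formula

Cell `bsd-print-cf2` (`run/shared/lean/pub/bsd-print-cf2/`), width seat `bsd-line-cf2-p1-w8` g22; odd twin of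
`PrintCf2DisegniPairTwoCompanionValueChi8.lean`. `--supports stmt-BirchSwinnertonDyer-20368` (helper). THEOREMS ONLY
(no `def`, no named fact, no `sorry`); conditional on every displayed hypothesis. BSD is not proved by any of this;
no summit statement is claimed; 20368 is not closed here.

## What is proved

In `quotient_law_chi4` (member `V^{(−1)}`, line `χ₋₄∘N = ω∘N`) the companion `W′` (newform `f′⊗χ₄`) enters through
`L(W′,1)` and through the CONSTANT TERM of the minus branch `L₂⁻(f′,ω,T)` at `T = 0`. By the tree's constant-term
formula at `2` (`constantCoeff_padicLFunctionMinusBranch_one_two_of_coeffField`: `= α⁻²([1/4]⁻_{f′} − [3/4]⁻_{f′})`) and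
Birch's odd formula (`ratMinusTwistedSymbolSum_mul_minusPeriod_mul_I`: `S₄⁻(f′)·Ω⁻_{f′}·i = τ(χ₄)·L(W′,1)`,
`S₄⁻ = [1/4]⁻ − [3/4]⁻`) they CANCEL:

* `ratMinusTwistedSymbolSum_chi4_eq` — `Σ_a χ₄(a)[a/4]⁻_g = [1/4]⁻_g − [3/4]⁻_g` (complex form);
* `ratMinusTwistedSymbolSum_chi4_mul_minusPeriod_eq` — Birch for a curve with newform `f′⊗χ₄`;
* ★★ `quotient_law_chi4_companion_free` — under the hypotheses of `quotient_law_chi4`: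
  `ι⁻¹(L′(W,1)·Z°·i)·h₂ = −σ₀·log₂5·ι⁻¹(ĥ(P)·u·Ω⁻_f·τ(χ₄))·ι₂(α⁻²)·[T¹]L₂⁻(f,ω)`; only `L(W′,1) ≠ 0` is used.

References: B. Mazur, J. Tate, J. Teitelbaum, Invent. Math. 84 (1986) §I.8 (8.6), §I.13–I.14 [MazurTateTeitelbaum1986Invent];
D. Disegni, Compos. Math. 153 (2017) Thm. B [Disegni2017]; B. Perrin-Riou, Invent. Math. 89 (1987) §1 [PerrinRiou1987].
-/

set_option autoImplicit false
set_option linter.dupNamespace false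

noncomputable section

open scoped Classical MatrixGroups ModularForm NumberField

open CongruenceSubgroup NumberField IsDedekindDomain WeierstrassCurve WeierstrassCurve.Affine.Point
  Literature.NumberTheory.EllipticCurves Literature.NumberTheory.EllipticCurves.ModularForms
  Literature.NumberTheory.EllipticCurves.Disegni2017 Literature.NumberTheory.GaloisRepresentations
  Summit.BirchSwinnertonDyer.Rank1Residual.AdditivePotMult

namespace Summit.BirchSwinnertonDyer.BirchSwinnertonDyer.Theorems.PrintCf2.DisegniPairTwo

section CompanionOdd

/-! ### §1 The `χ₄`-twisted minus symbol sum -/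

/-- **`Σ_{a mod 4} χ₄(a)[a/4]⁻_g = [1/4]⁻_g − [3/4]⁻_g`** (`χ₄(1) = 1`, `χ₄(3) = −1`, `χ₄(0) = χ₄(2) = 0`) — the
complex form of the odd-branch constant term at `2`. [cite: MazurTateTeitelbaum1986Invent, §I.13–I.14] -/
theorem ratMinusTwistedSymbolSum_chi4_eq {N : ℕ} (g : CuspForm (Gamma0 N) 2) :
    haveI : NeZero (2 ^ 2) := ⟨by norm_num⟩
    ratMinusTwistedSymbolSum g (ZMod.χ₄.ringHomComp (Int.castRingHom ℂ) : DirichletCharacter ℂ (2 ^ 2)) =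
      ((ratMinusSymbol g (1 / 4) - ratMinusSymbol g (3 / 4) : ℚ) : ℂ) := by
  haveI : NeZero (2 ^ 2) := ⟨by norm_num⟩
  set ψ := (ZMod.χ₄.ringHomComp (Int.castRingHom ℂ) : DirichletCharacter ℂ (2 ^ 2)) with hψ
  have hψv : ∀ a : ZMod 4, ψ a = ((ZMod.χ₄ a : ℤ) : ℂ) := by
    intro a
    rw [hψ, MulChar.ringHomComp_apply]
    rfl
  rw [ratMinusTwistedSymbolSum, Finset.sum_eq_add (1 : ZMod 4) 3 (by decide)]
  · rw [hψv, hψv, show ZMod.χ₄ (1 : ZMod 4) = 1 by decide, show ZMod.χ₄ (3 : ZMod 4) = -1 by decide,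
      show (1 : ZMod 4).val = 1 by decide, show (3 : ZMod 4).val = 3 by decide]
    simp only [Int.cast_one, Int.cast_neg, one_mul, neg_one_mul, Nat.cast_one, Nat.cast_ofNat, Rat.cast_sub,
      ← sub_eq_add_neg]
  · intro c _ hc
    have hc' : ∀ x : ZMod 4, x ≠ 1 ∧ x ≠ 3 → ZMod.χ₄ x = 0 := by decide
    rw [hψv, hc' c hc, Int.cast_zero, zero_mul]
  · intro h; exact absurd (Finset.mem_univ _) h
  · intro h; exact absurd (Finset.mem_univ _) h

/-- `χ₄ ⊗ ℂ` is its own inverse (a quadratic character). [folklore] -/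
theorem chi4_inv :
    haveI : NeZero (2 ^ 2) := ⟨by norm_num⟩
    (ZMod.χ₄.ringHomComp (Int.castRingHom ℂ) : DirichletCharacter ℂ (2 ^ 2))⁻¹ =
      (ZMod.χ₄.ringHomComp (Int.castRingHom ℂ) : DirichletCharacter ℂ (2 ^ 2)) :=
  (ZMod.isQuadratic_χ₄.comp (Int.castRingHom ℂ)).inv

/-! ### §2 Birch's odd formula for a curve with newform `f′ ⊗ χ₄` -/

/-- **Birch's odd formula for `f′ ⊗ χ₄`**: `W′/ℚ` elliptic with newform `g′`, `a_n(g′) = χ₄(n)·a_n(f′)`, modularity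
continuation `hmod`: `S₄⁻(f′)·Ω⁻_{f′}·i = τ(χ₄)·W′.entireLFunction 1` (tree `ratMinusTwistedSymbolSum_mul_minusPeriod_mul_I`
at the odd primitive `χ₄`). [cite: MazurTateTeitelbaum1986Invent, §I.8 (8.6)] -/
theorem ratMinusTwistedSymbolSum_chi4_mul_minusPeriod_eq (hmod : hasEntireLFunction_rat) {N' M' : ℕ}
    [NeZero N'] [NeZero M'] {f' : CuspForm (Gamma0 N') 2} {g' : CuspForm (Gamma0 M') 2} (hf' : IsNewform0 f')
    (hQ' : coeffField f' = ⊥) (W' : WeierstrassCurve ℚ) [W'.IsElliptic] (hg' : IsNewformOf W' g')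
    (hg'ε : ∀ m : ℕ, cuspCoeff g' m = (ZMod.χ₄.ringHomComp (Int.castRingHom ℂ)) m * cuspCoeff f' m) :
    haveI : NeZero (2 ^ 2) := ⟨by norm_num⟩
    ratMinusTwistedSymbolSum f' (ZMod.χ₄.ringHomComp (Int.castRingHom ℂ) : DirichletCharacter ℂ (2 ^ 2)) *
        (minusPeriod f' : ℂ) * Complex.I =
      gaussSum (ZMod.χ₄.ringHomComp (Int.castRingHom ℂ) : DirichletCharacter ℂ (2 ^ 2))
          (ZMod.stdAddChar (N := 2 ^ 2)) * W'.entireLFunction 1 := by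
  haveI : NeZero (2 ^ 2) := ⟨by norm_num⟩
  refine ratMinusTwistedSymbolSum_mul_minusPeriod_mul_I f' hf' hQ' chi4_isPrimitive chi4_odd
    (W'.differentiable_entireLFunction (hmod W')) (fun s hs ↦ ?_)
  rw [chi4_inv]
  exact entireLFunction_eq_twistedLSeries hmod W' hg'
    (ZMod.χ₄.ringHomComp (Int.castRingHom ℂ) : DirichletCharacter ℂ (2 ^ 2)) hg'ε hs

/-! ### §3 The companion-free quotient law on the `χ₋₄∘N`-line -/

variable (ι : PadicAlgCl 2 ≃+* ℂ) (K : Type) [Field K] [NumberField K] [IsGalois ℚ K]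

/-- ★★ **THE QUOTIENT LAW on the `χ₋₄∘N`-line, COMPANION-FREE.** Same hypotheses as `quotient_law_chi4`. Conclusion:
`ι⁻¹(L′(W,1)·Z°·i)·h₂ = −σ₀·log₂5·ι⁻¹(ĥ(P)·u·Ω⁻_f·τ(χ₄))·ι₂(α⁻²)·[T¹]L₂⁻(f,ω)` — `L(W′,1)` (archimedean side) has
cancelled against the constant term `L₂⁻(f′,ω,0) = α⁻²S₄⁻(f′)` via Birch's odd formula; only `L(W′,1) ≠ 0` was used.
[cite: Disegni2017, Theorem B (arXiv v3 PDF p. 8)] [cite: MazurTateTeitelbaum1986Invent, §I.8 (8.6), §I.13–I.14] [cite: PerrinRiou1987, §1] -/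
theorem quotient_law_chi4_companion_free (h2 : Module.finrank ℚ K = 2)
    (hsplit : ((Ideal.span {(2 : ℤ)}).primesOver (𝓞 K)).ncard = 2)
    (𝔭 𝔭' : HeightOneSpectrum (𝓞 K)) (h𝔭 : ((2 : ℕ) : 𝓞 K) ∈ 𝔭.asIdeal)
    (h𝔭' : ((2 : ℕ) : 𝓞 K) ∈ 𝔭'.asIdeal)
    (κ : DirichletCharacter ℂ (NumberField.discr K).natAbs)
    (hκ : ∀ ℓ : ℕ, ℓ.Prime → ℓ ≠ 2 → κ ℓ = (jacobiSym (NumberField.discr K) ℓ : ℂ))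
    (hκ2 : κ 2 = if NumberField.discr K % 8 = 1 then 1
        else if NumberField.discr K % 8 = 5 then -1 else 0)
    (hd : Nat.Coprime 2 (NumberField.discr K).natAbs)
    -- the good pair
    (V V' : WeierstrassCurve ℚ) [V.IsElliptic] [V.IsGloballyMinimal] [V'.IsElliptic] [V'.IsGloballyMinimal]
    (hordV : IsOrdinaryAt V 2) (hordV' : IsOrdinaryAt V' 2) (hap : V'.frobeniusTrace 2 = V.frobeniusTrace 2)
    {N N' : ℕ} [NeZero N] [NeZero N'] {f : CuspForm (Gamma0 N) 2}
    {f' : CuspForm (Gamma0 N') 2} (hfV : IsNewformOf V f) (hfV' : IsNewformOf V' f')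
    (hV' : ∀ n : ℕ, cuspCoeff f' n = κ (n : ZMod _) * cuspCoeff f n)
    (h0 : PowerSeries.constantCoeff (padicLFunctionMinusBranch f (unitRoot V 2 : ℚ_[2]) 1) = 0)
    -- the member and its companion (archimedean side)
    (hmod : hasEntireLFunction_rat) {M M' : ℕ} [NeZero M] [NeZero M']
    {g : CuspForm (Gamma0 M) 2} {g' : CuspForm (Gamma0 M') 2}
    (W W' : WeierstrassCurve ℚ) [W.IsElliptic] [W'.IsElliptic]
    (hg : IsNewformOf W g) (hg' : IsNewformOf W' g')
    (hgε : ∀ m : ℕ, cuspCoeff g m = (ZMod.χ₄.ringHomComp (Int.castRingHom ℂ)) m * cuspCoeff f m)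
    (hg'ε : ∀ m : ℕ, cuspCoeff g' m = (ZMod.χ₄.ringHomComp (Int.castRingHom ℂ)) m * cuspCoeff f' m)
    (hW1 : W.entireLFunction 1 = 0) (hL : deriv W.entireLFunction 1 ≠ 0) (hL' : W'.entireLFunction 1 ≠ 0)
    -- the tower frame and the sign character
    {H : Type} [Field H] [NumberField H] [Algebra K H] (hKH : Module.finrank K H = 2) {t : H}
    (htK : t ∉ Set.range (algebraMap K H)) (ht2 : t ^ 2 = algebraMap ℚ H (-1))
    (G : Subgroup (H ≃ₐ[ℚ] H)) (χ : G →* ℂˣ) (s : G → ℤ) (hs : ∀ σ, ((χ σ : ℂˣ) : ℂ) = (s σ : ℂ))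
    (τ : H ≃ₐ[ℚ] H) (hτG : τ ∈ G) (hsτ : s ⟨τ, hτG⟩ = -1)
    (hτK : ∀ a : K, τ (algebraMap K H a) = algebraMap K H a) (hτt : τ t = -t)
    {u : K} {e : ℚ} (hu : u ∉ Set.range (algebraMap ℚ K)) (hue : u ^ 2 = algebraMap ℚ K e)
    (c : K ≃ₐ[ℚ] K) (hcu : c u = -u)
    -- the member's Mordell–Weil data
    [(V.quadraticTwist (-1)).IsElliptic] {P : (V.quadraticTwist (-1)).toAffine.Point}
    (hgen : ∀ R : (V.quadraticTwist (-1)).toAffine.Point,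
      ∃ (k : ℤ) (T : (V.quadraticTwist (-1)).toAffine.Point), IsOfFinAddOrder T ∧ R = k • P + T)
    (htors : ∀ Q : ((V.quadraticTwist (-1)).quadraticTwist e).toAffine.Point, IsOfFinAddOrder Q)
    -- Disegni's datum: invariance, PIN, and the conjoined clauses (PRINT stub of the road)
    (DH : PAdicHeightDataK V 2 H)
    (hDH : ∀ (σ : G) (a b : (V.baseChange H).toAffine.Point),
      DH.pairing (pointGalHom V H σ.1 a) (pointGalHom V H σ.1 b) = DH.pairing a b)
    {h₂ : ℚ_[2]}
    (hpin : DH.pairing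
      (twistPointEquivOver V (not_mem_range_rat_of_not_mem_range htK) ht2
        (QuadraticDescent.incl H (V.quadraticTwist (-1)) P))
      (twistPointEquivOver V (not_mem_range_rat_of_not_mem_range htK) ht2
        (QuadraticDescent.incl H (V.quadraticTwist (-1)) P)) = h₂)
    (hGZ : ChiLineGrossZagierClauses ι K V H f (ι (((unitRoot V 2 : ℚ_[2]) : PadicAlgCl 2)))
      (baseChangeDirichlet K (ZMod.χ₄.ringHomComp (Int.castRingHom ℂ))) 𝔭 𝔭' G χ DH) :
    ∃ σ₀ : ℤˣ,
      ((ι.symm (deriv W.entireLFunction 1 *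
          zCirc (p := 2) (ι (((unitRoot V 2 : ℚ_[2]) : PadicAlgCl 2))) N
            (baseChangeDirichlet K (ZMod.χ₄.ringHomComp (Int.castRingHom ℂ))) 𝔭 𝔭' * Complex.I) :
          PadicAlgCl 2) : ℂ_[2]) * algebraMap ℚ_[2] ℂ_[2] h₂ =
      -((σ₀ : ℤ) : ℂ_[2]) * algebraMap ℚ_[2] ℂ_[2] (padicLog 2 (cyclotomicGenerator 2)) *
        ((ι.symm ((canonicalHeight P : ℂ) *
            ((splitLocalConstant 2 : ℂ) * (minusPeriod f : ℂ) *
              gaussSum (ZMod.χ₄.ringHomComp (Int.castRingHom ℂ) : DirichletCharacter ℂ (2 ^ 2))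
                (ZMod.stdAddChar (N := 2 ^ 2)))) : PadicAlgCl 2) : ℂ_[2]) *
        (algebraMap ℚ_[2] ℂ_[2] ((unitRoot V 2 : ℚ_[2])⁻¹ ^ 2) *
          algebraMap ℚ_[2] ℂ_[2] (PowerSeries.coeff 1 (padicLFunctionMinusBranch f (unitRoot V 2 : ℚ_[2]) 1))) := by
  haveI : NeZero (2 ^ 2) := ⟨by norm_num⟩
  obtain ⟨σ₀, hlaw⟩ := quotient_law_chi4 ι K h2 hsplit 𝔭 𝔭' h𝔭 h𝔭' κ hκ hκ2 hd V V' hordV hordV' hap hfV hfV'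
    hV' h0 hmod W W' hg hg' hgε hg'ε hW1 hL hL' hKH htK ht2 G χ s hs τ hτG hsτ hτK hτt hu hue c hcu hgen htors
    DH hDH hpin hGZ
  refine ⟨σ₀, ?_⟩
  set ψ : ℂ →+* ℂ_[2] := (algebraMap (PadicAlgCl 2) ℂ_[2]).comp ι.symm.toRingHom with hψ_def
  have hψ : ∀ z : ℂ, ((ι.symm z : PadicAlgCl 2) : ℂ_[2]) = ψ z := fun z => rfl
  set ι₂ := algebraMap ℚ_[2] ℂ_[2] with hι₂
  -- the companion's constant term: `L₂⁻(f′,ω,0) = α⁻²([1/4]⁻_{f′} − [3/4]⁻_{f′})`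
  obtain ⟨hαeq', -, hα0'⟩ := unitRoot_coe_spec (W := V') hordV'
  have hα' : (unitRoot V' 2 : ℚ_[2]) = (unitRoot V 2 : ℚ_[2]) := by
    rw [show unitRoot V' 2 = unitRoot V 2 by unfold unitRoot; rw [hap]]
  rw [hα', hap] at hαeq'
  rw [hα'] at hα0'
  have hf' : IsNewform0 f' := hfV'.1
  have hQ' : coeffField f' = ⊥ := hfV'.coeffField_eq_bot
  have hN' : ¬ 2 ∣ N' := not_dvd_level_of_isNewformOf hfV' hordV'.1
  have hapf' : cuspCoeff f' 2 = ((V.frobeniusTrace 2 : ℤ) : ℂ) := by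
    rw [← hap]; exact cuspCoeff_eq_frobeniusTrace_of_isNewformOf_holds hfV' hordV'.1
  have hαeq2' : (unitRoot V 2 : ℚ_[2]) ^ 2 - ((V.frobeniusTrace 2 : ℤ) : ℚ_[2]) * (unitRoot V 2 : ℚ_[2]) + 2 = 0 := by
    exact_mod_cast hαeq'
  have hconst := constantCoeff_padicLFunctionMinusBranch_one_two_of_coeffField f' hf' hQ' hN' hapf' hα0' hαeq2'
  -- as a complex number: `ι₂(const) = ι₂(α⁻²)·ψ(S₄⁻(f′))`
  have hSval : ψ (ratMinusTwistedSymbolSum f'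
      (ZMod.χ₄.ringHomComp (Int.castRingHom ℂ) : DirichletCharacter ℂ (2 ^ 2))) =
      ι₂ ((ratMinusSymbol f' (1 / 4) : ℚ_[2]) - (ratMinusSymbol f' (3 / 4) : ℚ_[2])) := by
    rw [ratMinusTwistedSymbolSum_chi4_eq, map_ratCast, ← Rat.cast_sub, map_ratCast]
  have hval : ι₂ (PowerSeries.constantCoeff (padicLFunctionMinusBranch f' (unitRoot V 2 : ℚ_[2]) 1)) =
      ι₂ ((unitRoot V 2 : ℚ_[2])⁻¹ ^ 2) *
        ψ (ratMinusTwistedSymbolSum f' (ZMod.χ₄.ringHomComp (Int.castRingHom ℂ) : DirichletCharacter ℂ (2 ^ 2))) := by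
    rw [hconst, map_mul, hSval]
  -- Birch (odd) for the companion
  have hBirch := ratMinusTwistedSymbolSum_chi4_mul_minusPeriod_eq hmod hf' hQ' W' hg' hg'ε
  -- non-vanishing
  have hτ : gaussSum (ZMod.χ₄.ringHomComp (Int.castRingHom ℂ) : DirichletCharacter ℂ (2 ^ 2))
      (ZMod.stdAddChar (N := 2 ^ 2)) ≠ 0 := gaussSum_stdAddChar_ne_zero chi4_isPrimitive
  have hΩ' : (minusPeriod f' : ℂ) ≠ 0 := by
    exact_mod_cast (IsNewform0.minusPeriod_pos_holds hf' hQ').ne'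
  have hI : Complex.I ≠ 0 := Complex.I_ne_zero
  have hS : ratMinusTwistedSymbolSum f'
      (ZMod.χ₄.ringHomComp (Int.castRingHom ℂ) : DirichletCharacter ℂ (2 ^ 2)) ≠ 0 := by
    intro h0S
    rw [h0S, zero_mul, zero_mul] at hBirch
    exact (mul_ne_zero hτ hL') hBirch.symm
  have hLW' : W'.entireLFunction 1 =
      ratMinusTwistedSymbolSum f' (ZMod.χ₄.ringHomComp (Int.castRingHom ℂ) : DirichletCharacter ℂ (2 ^ 2)) *
          (minusPeriod f' : ℂ) * Complex.I /
        gaussSum (ZMod.χ₄.ringHomComp (Int.castRingHom ℂ) : DirichletCharacter ℂ (2 ^ 2))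
          (ZMod.stdAddChar (N := 2 ^ 2)) := by
    rw [eq_div_iff hτ]; linear_combination -hBirch
  -- substitute and cancel `ψ(S₄⁻(f′))·ψ(Ω⁻_{f′})`
  rw [hLW', hval, hψ, hψ] at hlaw
  rw [hψ, hψ]
  have hψS : ψ (ratMinusTwistedSymbolSum f'
      (ZMod.χ₄.ringHomComp (Int.castRingHom ℂ) : DirichletCharacter ℂ (2 ^ 2))) ≠ 0 := (map_ne_zero ψ).mpr hS
  have hψΩ : ψ (minusPeriod f' : ℂ) ≠ 0 := (map_ne_zero ψ).mpr hΩ'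
  have hψτ : ψ (gaussSum (ZMod.χ₄.ringHomComp (Int.castRingHom ℂ) : DirichletCharacter ℂ (2 ^ 2))
      (ZMod.stdAddChar (N := 2 ^ 2))) ≠ 0 := (map_ne_zero ψ).mpr hτ
  have hψI : ψ Complex.I ≠ 0 := (map_ne_zero ψ).mpr hI
  simp only [map_mul, map_div₀] at hlaw ⊢
  field_simp at hlaw
  field_simp
  linear_combination hlaw

end CompanionOdd

end Summit.BirchSwinnertonDyer.BirchSwinnertonDyer.Theorems.PrintCf2.DisegniPairTwo

end
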